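import Literature.NumberTheory.EllipticCurves.ModularSymbolsManin
import HarnessLib

/-!
# Crux `ThetaLayerLambdaCongruenceAtTwo` (stmt-BirchSwinnertonDyer-20688, route ResidualThetaTransportAtTwo), line
# `birth`, stub (C3k) — ITEM B1: the UNIVERSAL MANIN CHAIN of `k ∈ SL₂(ℤ)` — one list of matrices that computes
# `{∞, k∞}` for EVERY coefficient system at once (lead prover bsd-wall-rtt-p3 g3;
# `--supports stmt-BirchSwinnertonDyer-20688 --as helper`; closes nothing)

HONEST FRAMING. Elementary THEOREMS (continued fractions on the first column); nothing about any curve or form is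
asserted; BSD is not proved by any of this.

WHAT. `exists_maninChain`: for every `k ∈ SL₂(ℤ)` there is a list `L = [g₁, …, g_n]` of matrices (the convergent
matrices `kTᵐ¹, k₁Tᵐ², …` of the Euclidean algorithm on the first column of `k`) such that for EVERY additive group
`A` and EVERY `F : SL₂(ℤ) → A` invariant under `g ↦ gT` and `g ↦ −g` (i.e. every function of the cusp `g·∞`):
  `Σᵢ (F(gᵢ) − F(gᵢS)) = F(k) − F(1)`.
This is the tree's `exists_chain` (Manin's trick for the period functionals `{∞, k∞}_h`) made UNIVERSAL in the
coefficients: the SAME chain serves the complex periods (`F = inftyFunctional`, §2: `msymbolMap N (chainVec L) =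
inftyFunctional k`), the boundary (`F g = e_{[g∞]}`, §2: `bdryMap N (chainVec L) = e_{[k∞]} − e_{[∞]}`) and any
abstract symbol function `Φ : ℚ → R` (`F = Φ̂`, §2: `Σᵢ [gᵢ]_Φ = Φ̂(k)`), where `chainVec L = Σᵢ e_{gᵢ⁻¹Γ₀(N)} ∈ ℤ^X`
is the integral chain on `X = SL₂(ℤ)/Γ₀(N)` in the tree's convention (`msymbol N (gΓ₀) = [g⁻¹]`). This is what lets a
`k`-valued Manin-symbol system be compared with the RATIONAL period homology (`…ManinSymbolTorsion`,
`Literature…ModularSymbolsManinExact`): the pairing of `chainVec L` with the Manin symbols of `Φ` IS `Φ̂(k)`.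

References: [Manin1972] Thm. 1.6; [CremonaAlgorithms1997] §2.2–2.3.
-/

noncomputable section

-- justification: the `Summit.BirchSwinnertonDyer.BirchSwinnertonDyer.…` path repeats a component (route-file convention)
set_option linter.dupNamespace false

open scoped Classical MatrixGroups

open CongruenceSubgroup Matrix.SpecialLinearGroup ModularGroup
open Literature.NumberTheory.EllipticCurves.ModularForms

namespace Summit.BirchSwinnertonDyer.BirchSwinnertonDyer.Theorems.ThetaLayerLambdaCongruenceAtTwo

universe u

/-! ## §1. The universal chain -/

section Chain

/-- A `T`-right-invariant function is `Tⁿ`-right-invariant (`n ∈ ℤ`). [folklore] -/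
theorem apply_mul_T_zpow_of_apply_mul_T {A : Type u} (F : SL(2, ℤ) → A) (hT : ∀ g, F (g * T) = F g)
    (g : SL(2, ℤ)) (n : ℤ) : F (g * T ^ n) = F g := by
  have hT' : ∀ g, F (g * T⁻¹) = F g := fun g ↦ by
    have := hT (g * T⁻¹); rw [inv_mul_cancel_right] at this; exact this.symm
  induction n using Int.induction_on generalizing g with
  | zero => rw [zpow_zero, mul_one]
  | succ n ih => rw [zpow_add_one, ← mul_assoc, hT, ih]
  | pred n ih => rw [zpow_sub_one, ← mul_assoc, hT', ih]

/-- **The universal Manin chain of `k`.** There is a list `L` of matrices such that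
`Σ_{g ∈ L} (F g − F (gS)) = F k − F 1` for every `F : SL₂(ℤ) → A` (any additive group `A`) with `F(gT) = F(g)` and
`F(−g) = F(g)`. (Euclid on the first column: `k ↦ k' = kTᵐS`, `|k'₁₀| < |k₁₀|`, contributing `g = kTᵐ`; at `k₁₀ = 0`,
`k = ±Tʲ` and `F k = F 1`.) [cite: Manin1972, Thm. 1.6] -/
theorem exists_maninChain (k : SL(2, ℤ)) :
    ∃ L : List SL(2, ℤ), ∀ {A : Type u} [AddCommGroup A] (F : SL(2, ℤ) → A),
      (∀ g, F (g * T) = F g) → (∀ g, F (-g) = F g) → (L.map fun g ↦ F g - F (g * S)).sum = F k - F 1 := by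
  suffices H : ∀ n : ℕ, ∀ k : SL(2, ℤ), (k 1 0).natAbs = n →
      ∃ L : List SL(2, ℤ), ∀ {A : Type u} [AddCommGroup A] (F : SL(2, ℤ) → A),
        (∀ g, F (g * T) = F g) → (∀ g, F (-g) = F g) → (L.map fun g ↦ F g - F (g * S)).sum = F k - F 1 from
    H _ k rfl
  intro n
  induction n using Nat.strong_induction_on with
  | _ n ih =>
    intro k hk
    by_cases hz : k 1 0 = 0
    · -- `k = ± T^j`
      refine ⟨[], fun F hT hneg ↦ ?_⟩
      rw [List.map_nil, List.sum_nil]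
      have hdet := Matrix.SpecialLinearGroup.det_coe k
      rw [Matrix.det_fin_two, hz, mul_zero, sub_zero] at hdet
      -- `k 0 0 = k 1 1 = ±1`
      rcases Int.eq_one_or_neg_one_of_mul_eq_one hdet with h00 | h00
      · have h11 : k 1 1 = 1 := by rw [h00, one_mul] at hdet; exact hdet
        have hkT : k = 1 * T ^ (k 0 1) := by
          ext i j
          fin_cases i <;> fin_cases j <;> simp [coe_T_zpow, h00, h11, hz]
        rw [hkT, apply_mul_T_zpow_of_apply_mul_T F hT, sub_self]
      · have h11 : k 1 1 = -1 := by
          rw [h00] at hdet; linarith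
        have hkT : k = -(1 * T ^ (-(k 0 1))) := by
          ext i j
          fin_cases i <;> fin_cases j <;> simp [coe_T_zpow, h00, h11, hz]
        rw [hkT, hneg, apply_mul_T_zpow_of_apply_mul_T F hT, sub_self]
    · -- Euclidean step
      set m : ℤ := -(k 1 1 / k 1 0) with hm
      set k' : SL(2, ℤ) := k * T ^ m * S with hk'
      have hk'10 : k' 1 0 = k 1 1 % k 1 0 := by
        simp only [hk', coe_mul, coe_S, coe_T_zpow, Matrix.mul_apply, Fin.sum_univ_two]
        simp [hm, Int.emod_def]
        ring
      have hlt : (k' 1 0).natAbs < n := by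
        rw [← hk, hk'10]
        have h0 := Int.emod_nonneg (k 1 1) hz
        have h1 := Int.emod_lt_abs (k 1 1) hz
        zify
        rw [abs_of_nonneg h0]
        exact h1
      obtain ⟨L', hL'⟩ := ih _ hlt k' rfl
      refine ⟨(k * T ^ m) :: L', fun F hT hneg ↦ ?_⟩
      rw [List.map_cons, List.sum_cons, hL' F hT hneg, apply_mul_T_zpow_of_apply_mul_T F hT]
      abel

end Chain

/-! ## §2. The three readings of one chain: periods, boundary, and any symbol function -/

section Readings

variable {N : ℕ} [NeZero N]

/-- The complex period reading: `Σ_{g ∈ L} [g]_h = {∞, k∞}_h` — on functionals,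
`Σ msymbolFunctional g = inftyFunctional k`. [cite: Manin1972, Thm. 1.6] -/
theorem maninChain_sum_msymbolFunctional {k : SL(2, ℤ)} {L : List SL(2, ℤ)}
    (hL : ∀ {A : Type} [AddCommGroup A] (F : SL(2, ℤ) → A),
      (∀ g, F (g * T) = F g) → (∀ g, F (-g) = F g) → (L.map fun g ↦ F g - F (g * S)).sum = F k - F 1) :
    (L.map fun g ↦ (msymbolFunctional g : Module.Dual ℂ (CuspForm (Gamma0 N) 2))).sum =
      inftyFunctional k := by
  have h := hL (fun g ↦ (inftyFunctional g : Module.Dual ℂ (CuspForm (Gamma0 N) 2)))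
    (fun g ↦ by ext h; simp [inftySymbol_mul_T]) (fun g ↦ by ext h; simp [inftySymbol_neg])
  have e1 : (inftyFunctional (1 : SL(2, ℤ)) : Module.Dual ℂ (CuspForm (Gamma0 N) 2)) = 0 := by
    ext h; simp
  rw [e1, sub_zero] at h
  rw [← h]
  rfl

/-- The boundary reading: `Σ_{g ∈ L} (e_{[g∞]} − e_{[gS∞]}) = e_{[k∞]} − e_{[∞]}`. [cite: Manin1972, Thm. 1.6] -/
theorem maninChain_sum_cuspOrbitOf {k : SL(2, ℤ)} {L : List SL(2, ℤ)}
    (hL : ∀ {A : Type} [AddCommGroup A] (F : SL(2, ℤ) → A),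
      (∀ g, F (g * T) = F g) → (∀ g, F (-g) = F g) → (L.map fun g ↦ F g - F (g * S)).sum = F k - F 1) :
    (L.map fun g ↦ (Pi.single (cuspOrbitOf N g) (1 : ℚ) - Pi.single (cuspOrbitOf N (g * S)) 1 :
        CuspOrbits (Gamma0 N : Subgroup (GL (Fin 2) ℝ)) → ℚ)).sum =
      Pi.single (cuspOrbitOf N k) 1 - Pi.single (cuspOrbitOf N 1) 1 :=
  hL (fun g ↦ (Pi.single (cuspOrbitOf N g) (1 : ℚ) : CuspOrbits (Gamma0 N : Subgroup (GL (Fin 2) ℝ)) → ℚ))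
    (fun g ↦ by rw [← zpow_one T, cuspOrbitOf_mul_T_zpow]) (fun g ↦ by rw [cuspOrbitOf_neg])

/-- The abstract reading: for ANY function `Φ : ℚ → R`, `Σ_{g ∈ L} [g]_Φ = Φ̂(k)` where `Φ̂(g) = Φ(g·∞)` (`0` at
`g·∞ = ∞`) and `[g]_Φ = Φ̂(g) − Φ̂(gS)` is the Manin symbol of `…ManinSymbols`. [cite: Manin1972, Thm. 1.6] -/
theorem maninChain_sum_maninSymbol {R : Type} [AddCommGroup R] (Φ : ℚ → R) {k : SL(2, ℤ)} {L : List SL(2, ℤ)}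
    (hL : ∀ {A : Type} [AddCommGroup A] (F : SL(2, ℤ) → A),
      (∀ g, F (g * T) = F g) → (∀ g, F (-g) = F g) → (L.map fun g ↦ F g - F (g * S)).sum = F k - F 1) :
    (L.map fun g ↦
        ((if (g 1 0) = 0 then 0 else Φ (((g 0 0 : ℚ)) / ((g 1 0 : ℚ)))) -
          (if ((g * S) 1 0) = 0 then 0 else Φ ((((g * S) 0 0 : ℚ)) / (((g * S) 1 0 : ℚ)))))).sum =
      (if (k 1 0) = 0 then 0 else Φ (((k 0 0 : ℚ)) / ((k 1 0 : ℚ)))) := by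
  have h := hL (fun g : SL(2, ℤ) ↦ (if (g 1 0) = 0 then (0 : R) else Φ (((g 0 0 : ℚ)) / ((g 1 0 : ℚ)))))
    (fun g ↦ by
      have e0 : (g * T) 0 0 = g 0 0 := by simp [coe_mul, coe_T, Matrix.mul_apply, Fin.sum_univ_two]
      have e1 : (g * T) 1 0 = g 1 0 := by simp [coe_mul, coe_T, Matrix.mul_apply, Fin.sum_univ_two]
      simp only [e0, e1])
    (fun g ↦ by
      have e0 : (-g) 0 0 = -g 0 0 := by simp
      have e1 : (-g) 1 0 = -g 1 0 := by simp
      simp only [e0, e1, neg_eq_zero, Int.cast_neg, neg_div_neg_eq])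
  have e1 : (if ((1 : SL(2, ℤ)) 1 0) = 0 then (0 : R) else Φ ((((1 : SL(2, ℤ)) 0 0 : ℚ)) / (((1 : SL(2, ℤ)) 1 0 : ℚ)))) = 0 := by
    rw [if_pos]; simp
  rw [e1, sub_zero] at h
  exact h

end Readings

end Summit.BirchSwinnertonDyer.BirchSwinnertonDyer.Theorems.ThetaLayerLambdaCongruenceAtTwo

end
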